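/-
Copyright (c) 2026 the pub-hodgecm-mathlib formalisation cell (harness21).  Prover seat hodgecm-mathlib-K2Liu-p10 (g4), Track B «K2-LIT»,
#184♮ = hLiu418 = `stmt-HodgeConjecture-24832`; organ S2 (RULING M-158g road (γ): the multi-place carrier), S2-K file K-4: THE SLOT HOMOMORPHISM.
Requested by K2Liu-p11 (g2) 13:46:30Z (ii) ∕ K2Liu-p14 (g2) for `K2LiuSlotwiseSubmoduleInduction` ∕ `K2LiuArchSWImageSlotStability`.
-/
import Summits.HodgeConjecture.HodgeConjecture.Theorems.K2LiuU22CompactPictureDefs   -- ★ S2-K DEFS p860097 (`Carrier`, `uMat`, `dInv`, `pd`, the generic operators)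
import HarnessLib

/-!
# Crux `HLiu418`, organ S2, S2-K file K-4: THE SLOT HOMOMORPHISM `φ : 𝒜 = ℂ[u, D⁻¹] →ₐ[ℂ] R` INTO ANY ALGEBRA CARRYING ONE-PLACE DATA, AND ITS INTERTWINING
# `φ ∘ ∂_{ij} = d_{ij} ∘ φ`, `φ ∘ X_𝒜 = X_R ∘ φ` FOR `X ∈ {R_{ab}, L_{ab}, E, C, P_{ab}, M_{ab}}`

Cell `hodgecm-mathlib`, crux item hLiu418 = `stmt-HodgeConjecture-24832`, route of record `HCCMUnconditional`; squad K2 ∕ K2Liu, prover K2Liu-p10 (g4).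
ONE DEFINITION WITH BODY (`slotHom`) + theorems; no instance, no notation, no named fact, no `sorry`; definition lane, `--supports stmt-HodgeConjecture-24832 --as helper`.

Road (γ) (RULING M-158g) reads the multi-place compact picture in ONE commutative ℂ-algebra `R` carrying, for each place `w`, one-place data `(d_w, u_w, Dinv_w)` with the two
laws of ★ S2-K DEFS (`hd : d i j (u k l) = δ`, `hD : det u · Dinv = 1`); the one-place K-type theory (★ K-1 … K-2c, stated on `Carrier`) is moved into `R` along the
**slot homomorphism** of this file:
* §1 **`slotHom u Dinv hD : Carrier →ₐ[ℂ] R`** — the universal map of the localisation (`X_{ij} ↦ u_{ij}`, `D⁻¹ ↦ Dinv`; ★ `IsLocalization.Away.lift`, exactly as ★ DEFS `evalAt`),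
  `slotHom_algebraMap`, **`slotHom_uMat`**, **`slotHom_dInv`**, `slotHom_det_uMat`, `slotHom_dz`;
* §2 **`d_slotHom : d i j (φ a) = φ (pd i j a)`** for EVERY `a ∈ 𝒜` (given `hd`, `hD`): two derivations over `φ` agreeing on the generators `u_{ij}` agree on polynomials, on `D⁻¹`
  (`d(D⁻¹) = −D⁻² d(D)` on both sides, ★ `pd_dInv`), and on products — ★ `IsLocalization.surj`;
* §3 the OPERATOR INTERTWININGS **`slotHom_rOp`**, **`slotHom_lOp`**, **`slotHom_euler`**, **`slotHom_casimir`**, **`slotHom_pOp`**, **`slotHom_mOp`**, `slotHom_dMat`: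
  `φ (X_{pd,uMat,dInv} f) = X_{d,u,Dinv} (φ f)` — so `φ` carries ★ K-type memberships ∕ identities ∕ transitions into `R` (p11's (slot) binder, p14's FILE 2′).

HONEST LABEL: HC_CM is proved only modulo the 7 printed citations (2 remaining named inputs: hLiu418 = stmt-HodgeConjecture-24832, h413 = stmt-HodgeConjecture-24833)
until rung 0 closes; this file defines a carrier map and closes no item.
References: [KashiwaraVergne1978] §II.5; [Howe1989Remarks] §2; [LeeZhu1998] p. 5032.
-/

set_option autoImplicit false
set_option linter.dupNamespace false -- the mandated namespace repeats `HodgeConjecture.HodgeConjecture`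

noncomputable section

open Matrix MvPolynomial
open Summit.HodgeConjecture.HodgeConjecture.Cruxes.HLiu418.K2LiuU22CompactPictureDefs

namespace Summit.HodgeConjecture.HodgeConjecture.Cruxes.HLiu418.K2LiuU22CompactPictureSlotHom

variable {R : Type*} [CommRing R] [Algebra ℂ R] (d : Fin 2 → Fin 2 → Derivation ℂ R R) (u : Matrix (Fin 2) (Fin 2) R) (Dinv : R)

/-! ## §1 The slot homomorphism -/

/-- evaluation of `D` at `u` is `det u`. [cite: KashiwaraVergne1978, §II.5] -/
theorem aeval_detPoly_eq_det : MvPolynomial.aeval (fun kl : Fin 2 × Fin 2 => u kl.1 kl.2) detPoly = u.det := by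
  rw [detPoly, Matrix.det_fin_two]
  simp

/-- under `hD : det u · Dinv = 1` the image of `D` is a unit. [cite: KashiwaraVergne1978, §II.5] -/
theorem isUnit_aeval_detPoly_of (hD : u.det * Dinv = 1) : IsUnit ((MvPolynomial.aeval fun kl : Fin 2 × Fin 2 => u kl.1 kl.2).toRingHom detPoly) := by
  rw [AlgHom.toRingHom_eq_coe, RingHom.coe_coe, aeval_detPoly_eq_det]
  exact isUnit_iff_exists_inv.2 ⟨Dinv, hD⟩

/-- **THE SLOT HOMOMORPHISM `φ : 𝒜 →ₐ[ℂ] R`**, `X_{ij} ↦ u_{ij}`, `D⁻¹ ↦ Dinv` — the universal map of the localisation `𝒜 = ℂ[X][D⁻¹]` into an algebra where `det u` is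
inverted by `Dinv`. [cite: KashiwaraVergne1978, §II.5] [cite: LeeZhu1998, p. 5032] -/
def slotHom (hD : u.det * Dinv = 1) : Carrier →ₐ[ℂ] R :=
  { IsLocalization.Away.lift detPoly (g := (MvPolynomial.aeval fun kl : Fin 2 × Fin 2 => u kl.1 kl.2).toRingHom) (isUnit_aeval_detPoly_of u Dinv hD) with
    commutes' := fun c => by
      simp only [AlgHom.toRingHom_eq_coe, RingHom.toMonoidHom_eq_coe, OneHom.toFun_eq_coe, MonoidHom.toOneHom_coe, MonoidHom.coe_coe]
      rw [IsScalarTower.algebraMap_apply ℂ (MvPolynomial (Fin 2 × Fin 2) ℂ) Carrier, IsLocalization.Away.lift_eq, RingHom.coe_coe, AlgHom.commutes] }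

/-- on polynomials `φ` is evaluation at `u`. [cite: KashiwaraVergne1978, §II.5] -/
theorem slotHom_algebraMap (hD : u.det * Dinv = 1) (P : MvPolynomial (Fin 2 × Fin 2) ℂ) :
    slotHom u Dinv hD (algebraMap (MvPolynomial (Fin 2 × Fin 2) ℂ) Carrier P) = MvPolynomial.aeval (fun kl : Fin 2 × Fin 2 => u kl.1 kl.2) P :=
  IsLocalization.Away.lift_eq detPoly (isUnit_aeval_detPoly_of u Dinv hD) P

/-- **`φ (u_{ij}) = u_{ij}`**. [cite: LeeZhu1998, p. 5032] -/
theorem slotHom_uMat (hD : u.det * Dinv = 1) (i j : Fin 2) : slotHom u Dinv hD (uMat i j) = u i j := by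
  rw [uMat_apply, slotHom_algebraMap, MvPolynomial.aeval_X]

/-- `φ (det u_𝒜) = det u`. [cite: KashiwaraVergne1978, §II.5] -/
theorem slotHom_det_uMat (hD : u.det * Dinv = 1) : slotHom u Dinv hD uMat.det = u.det := by
  rw [det_uMat, slotHom_algebraMap, aeval_detPoly_eq_det]

/-- **`φ (D⁻¹) = Dinv`**. [cite: LeeZhu1998, p. 5032] -/
theorem slotHom_dInv (hD : u.det * Dinv = 1) : slotHom u Dinv hD dInv = Dinv := by
  have h := congrArg (slotHom u Dinv hD) det_uMat_mul_dInv
  rw [map_mul, map_one, slotHom_det_uMat] at h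
  -- `det u · φ(D⁻¹) = 1 = det u · Dinv`
  calc slotHom u Dinv hD dInv = (u.det * Dinv) * slotHom u Dinv hD dInv := by rw [hD, one_mul]
    _ = Dinv * (u.det * slotHom u Dinv hD dInv) := by ring
    _ = Dinv := by rw [h, mul_one]

/-- `φ` is matrix evaluation entrywise: `φ.mapMatrix u_𝒜 = u`. [cite: LeeZhu1998, p. 5032] -/
theorem slotHom_map_uMat (hD : u.det * Dinv = 1) : uMat.map (slotHom u Dinv hD) = u := by
  ext i j
  exact slotHom_uMat u Dinv hD i j

/-- `φ (adj u_𝒜)_{ij} = (adj u)_{ij}`. [cite: LeeZhu1998, p. 5032] -/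
theorem slotHom_adjugate (hD : u.det * Dinv = 1) (i j : Fin 2) : slotHom u Dinv hD (uMat.adjugate i j) = u.adjugate i j := by
  have h := (AlgHom.map_adjugate (slotHom u Dinv hD) uMat)
  rw [AlgHom.mapMatrix_apply, AlgHom.mapMatrix_apply, slotHom_map_uMat] at h
  have hij := congrFun (congrFun h i) j
  rw [Matrix.map_apply] at hij
  exact hij

/-! ## §2 `φ` intertwines the formal partials with the derivations of `R` -/

section Intertwine

variable (hd : ∀ i j k l : Fin 2, d i j (u k l) = if i = k ∧ j = l then 1 else 0) (hD : u.det * Dinv = 1)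
include hd

omit hd in
/-- the derivation identity on products: if it holds for `a` and `b` it holds for `a * b`. [folklore] -/
theorem d_slotHom_mul (i j : Fin 2) {a b : Carrier} (ha : d i j (slotHom u Dinv hD a) = slotHom u Dinv hD (pd i j a))
    (hb : d i j (slotHom u Dinv hD b) = slotHom u Dinv hD (pd i j b)) :
    d i j (slotHom u Dinv hD (a * b)) = slotHom u Dinv hD (pd i j (a * b)) := by
  rw [map_mul, Derivation.leibniz, Derivation.leibniz, map_add, smul_eq_mul, smul_eq_mul, smul_eq_mul, smul_eq_mul, map_mul, map_mul, ha, hb]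

/-- … on polynomials. [cite: KashiwaraVergne1978, §II.5] -/
theorem d_slotHom_algebraMap (i j : Fin 2) (P : MvPolynomial (Fin 2 × Fin 2) ℂ) :
    d i j (slotHom u Dinv hD (algebraMap (MvPolynomial (Fin 2 × Fin 2) ℂ) Carrier P)) =
      slotHom u Dinv hD (pd i j (algebraMap (MvPolynomial (Fin 2 × Fin 2) ℂ) Carrier P)) := by
  induction P using MvPolynomial.induction_on with
  | C c =>
    have hc : algebraMap (MvPolynomial (Fin 2 × Fin 2) ℂ) Carrier (C c) = algebraMap ℂ Carrier c :=
      (IsScalarTower.algebraMap_apply ℂ (MvPolynomial (Fin 2 × Fin 2) ℂ) Carrier c).symm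
    rw [hc, AlgHom.commutes, Derivation.map_algebraMap, Derivation.map_algebraMap, map_zero]
  | add p q hp hq => rw [map_add, map_add, map_add, map_add, map_add, hp, hq]
  | mul_X p ij hp =>
    rw [map_mul]
    refine d_slotHom_mul d u Dinv hD i j hp ?_
    rw [← uMat_apply, slotHom_uMat, hd, pd_uMat]
    split_ifs
    · rw [map_one]
    · rw [map_zero]

/-- … on `det u_𝒜`. [cite: KashiwaraVergne1978, §II.5] -/
theorem d_slotHom_det (i j : Fin 2) : d i j (slotHom u Dinv hD uMat.det) = slotHom u Dinv hD (pd i j uMat.det) := by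
  rw [det_uMat]
  exact d_slotHom_algebraMap d u Dinv hd hD i j detPoly

/-- … on `D⁻¹` (`d(D⁻¹) = −D⁻²·d(D)` on both sides). [cite: KashiwaraVergne1978, §II.5] -/
theorem d_slotHom_dInv (i j : Fin 2) : d i j (slotHom u Dinv hD dInv) = slotHom u Dinv hD (pd i j dInv) := by
  rw [pd_dInv, map_mul, map_neg, map_mul, slotHom_dInv, ← d_slotHom_det d u Dinv hd hD, slotHom_det_uMat]
  -- `d Dinv = -(Dinv·Dinv)·d(det u)` from `det u · Dinv = 1`
  have h0 : d i j (u.det * Dinv) = 0 := by rw [hD, Derivation.map_one_eq_zero]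
  rw [Derivation.leibniz, smul_eq_mul, smul_eq_mul] at h0
  -- h0 : det u * d Dinv + Dinv * d det = 0
  calc d i j Dinv = (u.det * Dinv) * d i j Dinv := by rw [hD, one_mul]
    _ = Dinv * (u.det * d i j Dinv) := by ring
    _ = Dinv * (-(Dinv * d i j u.det)) := by rw [eq_neg_of_add_eq_zero_left h0]
    _ = -(Dinv * Dinv) * d i j u.det := by ring

/-- … on powers of `D⁻¹`. [cite: KashiwaraVergne1978, §II.5] -/
theorem d_slotHom_dInv_pow (i j : Fin 2) (n : ℕ) : d i j (slotHom u Dinv hD (dInv ^ n)) = slotHom u Dinv hD (pd i j (dInv ^ n)) := by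
  induction n with
  | zero => rw [pow_zero, map_one, Derivation.map_one_eq_zero, Derivation.map_one_eq_zero, map_zero]
  | succ m ih => rw [pow_succ]; exact d_slotHom_mul d u Dinv hD i j ih (d_slotHom_dInv d u Dinv hd hD i j)

/-- **`d_{ij} ∘ φ = φ ∘ ∂_{ij}` ON ALL OF `𝒜`**. [cite: KashiwaraVergne1978, §II.5] [cite: LeeZhu1998, p. 5032] -/
theorem d_slotHom (i j : Fin 2) (a : Carrier) : d i j (slotHom u Dinv hD a) = slotHom u Dinv hD (pd i j a) := by
  obtain ⟨⟨P, D, n, hn⟩, hP⟩ := IsLocalization.surj (Submonoid.powers detPoly) a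
  simp only at hn hP
  have ha : a = dInv ^ n * algebraMap (MvPolynomial (Fin 2 × Fin 2) ℂ) Carrier P := by
    have hP' : a * uMat.det ^ n = algebraMap (MvPolynomial (Fin 2 × Fin 2) ℂ) Carrier P := by
      rw [det_uMat, ← map_pow, hn]; exact hP
    calc a = a * (uMat.det ^ n * dInv ^ n) := by rw [← mul_pow, det_uMat_mul_dInv, one_pow, mul_one]
      _ = dInv ^ n * algebraMap (MvPolynomial (Fin 2 × Fin 2) ℂ) Carrier P := by rw [← mul_assoc, hP', mul_comm]
  rw [ha]
  exact d_slotHom_mul d u Dinv hD i j (d_slotHom_dInv_pow d u Dinv hd hD i j n) (d_slotHom_algebraMap d u Dinv hd hD i j P)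

/-! ## §3 The operator intertwinings -/

/-- **`φ (R_{ab} f) = R_{ab} (φ f)`**. [cite: LeeZhu1998, p. 5032] -/
theorem slotHom_rOp (a b : Fin 2) (f : Carrier) : slotHom u Dinv hD (rOp pd uMat a b f) = rOp d u a b (slotHom u Dinv hD f) := by
  rw [rOp_apply, rOp_apply, map_sum]
  refine Finset.sum_congr rfl fun k _ => ?_
  rw [map_mul, slotHom_uMat, d_slotHom d u Dinv hd hD]

/-- **`φ (L_{ab} f) = L_{ab} (φ f)`**. [cite: LeeZhu1998, p. 5032] -/
theorem slotHom_lOp (a b : Fin 2) (f : Carrier) : slotHom u Dinv hD (lOp pd uMat a b f) = lOp d u a b (slotHom u Dinv hD f) := by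
  rw [lOp_apply, lOp_apply, map_sum]
  refine Finset.sum_congr rfl fun k _ => ?_
  rw [map_mul, slotHom_uMat, d_slotHom d u Dinv hd hD]

/-- `φ (d_Y f) = d_{φ Y} (φ f)`. [cite: LeeZhu1998, p. 5032] -/
theorem slotHom_dMat (Y : Matrix (Fin 2) (Fin 2) Carrier) (f : Carrier) :
    slotHom u Dinv hD (dMat pd Y f) = dMat d (Y.map (slotHom u Dinv hD)) (slotHom u Dinv hD f) := by
  rw [dMat_apply, dMat_apply, map_sum]
  refine Finset.sum_congr rfl fun i _ => ?_
  rw [map_sum]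
  refine Finset.sum_congr rfl fun j _ => ?_
  rw [map_mul, Matrix.map_apply, d_slotHom d u Dinv hd hD]

/-- **`φ (E f) = E (φ f)`**. [cite: Howe1989Remarks, §2] -/
theorem slotHom_euler (f : Carrier) : slotHom u Dinv hD (euler pd uMat f) = euler d u (slotHom u Dinv hD f) := by
  rw [euler_apply, euler_apply, map_sum]
  refine Finset.sum_congr rfl fun i _ => ?_
  rw [map_sum]
  refine Finset.sum_congr rfl fun j _ => ?_
  rw [map_mul, slotHom_uMat, d_slotHom d u Dinv hd hD]

/-- **`φ (C f) = C (φ f)`**. [cite: Howe1989Remarks, §2] -/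
theorem slotHom_casimir (f : Carrier) : slotHom u Dinv hD (casimir pd uMat f) = casimir d u (slotHom u Dinv hD f) := by
  rw [casimir_apply, casimir_apply, map_sum]
  refine Finset.sum_congr rfl fun a _ => ?_
  rw [map_sum]
  refine Finset.sum_congr rfl fun b _ => ?_
  rw [slotHom_rOp d u Dinv hd hD, slotHom_rOp d u Dinv hd hD]

/-- **`φ (P_{ab} f) = P_{ab} (φ f)`** (the 𝔭⁺ transition operators of ★ S2-T). [cite: LeeZhu1998, p. 5032] -/
theorem slotHom_pOp (p : ℂ) (a b : Fin 2) (f : Carrier) : slotHom u Dinv hD (pOp pd uMat dInv p a b f) = pOp d u Dinv p a b (slotHom u Dinv hD f) := by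
  rw [pOp_apply, pOp_apply, map_sub, map_smul, map_mul, map_mul, slotHom_dInv, slotHom_adjugate, d_slotHom d u Dinv hd hD]

/-- **`φ (M_{ab} f) = M_{ab} (φ f)`** (the 𝔭⁻ transition operators of ★ S2-T). [cite: LeeZhu1998, p. 5032] -/
theorem slotHom_mOp (q : ℂ) (a b : Fin 2) (f : Carrier) : slotHom u Dinv hD (mOp pd uMat q a b f) = mOp d u q a b (slotHom u Dinv hD f) := by
  rw [mOp_apply, mOp_apply, map_add, map_smul, map_mul, slotHom_uMat, map_sum]
  congr 1
  refine Finset.sum_congr rfl fun i _ => ?_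
  rw [map_sum]
  refine Finset.sum_congr rfl fun j _ => ?_
  rw [map_mul, map_mul, slotHom_uMat, slotHom_uMat, d_slotHom d u Dinv hd hD]

end Intertwine

end Summit.HodgeConjecture.HodgeConjecture.Cruxes.HLiu418.K2LiuU22CompactPictureSlotHom

end
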